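import Literature.Probability.RandomPlanarGeometry.HexSAWRotSurfaceYcLimit
import Mathlib.Analysis.MeanInequalities
import Mathlib.Analysis.SpecialFunctions.Pow.Real
import HarnessLib

/-!
# «HEX-YC-ROT-DENSITY-SUB» The mean density of surface vertices in Beaton's rotated half-plane:
# `→ 0` for `y < y_c = rotYdagger` with exponentially small tails, bounded below for `y > y_c`

Topic `Literature/Probability/RandomPlanarGeometry` (continues `HexSAWRotSurfaceYcGrowth.lean` — `HV.rotHpWalks n`,
`HV.rotHpCoeff n y = C⁺_n(y)`, `RotGrowthLe` / `RotGrowthGt`, `rotGrowthLe_criticalPoint`, `rotGrowthGt_holds`,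
`surfCount_le_length` — and `HexSAWRotSurfaceYcLimit.lean` — the EVENTUAL lower rate `RotGrowthGeRate`,
`rotGrowthGeRate_mu_of_pos`; Beaton's rotated orientation of the surface, critical fugacity `y_c = rotYdagger = hexRotSurfaceYc`).

Source: N. R. Beaton, *The critical surface fugacity of self-avoiding walks on a rotated honeycomb lattice*, J. Phys. A 47
(2014) 075003 (arXiv:1210.0274v3), §3.1, its last paragraph, after the proof of Proposition 7 (arXiv v3 p. 14; Proposition 7 itself is stated on p. 11): "A quantity
of much interest is the mean density of vertices in the surface, given by
`(1/n) Σ_m m c^+_n(m) y^m / Σ_m c_n^+(m) y^m = (y/n) ∂ log C^+_n(y)/∂y`. In the limit of infinitely long walks, this density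
tends to `y ∂ log μ(y)/∂y`. From the behaviour of `μ(y)` given in Proposition 7, it can be seen that the density of vertices
in the surface is `0` for `y < y_c` and is positive for `y > y_c`."  As in print for the un-rotated orientation, the printed
route goes through the LIMIT free energy `log μ(y)`, its convexity and the exchange of limit and derivative.  This file is
the rotated twin of `HexSAWSurfaceDensity.lean`: junk-free FINITE-`n` statements from the tree's growth rates, with no limit
free energy and no derivative, the only convexity input being one weighted AM–GM step:

* vocabulary: the surface moment `rotSurfMoment n y = Σ_γ m(γ) y^{m(γ)}` over `rotHpWalks n` (`m = surfCount`), the **mean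
  density `rotSurfDensity n y = rotSurfMoment n y / (n C⁺_n(y))`** (the printed left-hand side), the tail
  `rotSurfTail n t y = Σ_{γ : m(γ) ≥ t} y^{m(γ)}`; `0 ≤ rotSurfDensity n y ≤ 1`;
* `rotSurfMoment_le_add` (Markov splitting) and `rotSurfTail_le_pow_mul : rotSurfTail n t y ≤ (y/y')^t C⁺_n(y')` (`0 < y ≤ y'`);
* **`exists_rate_rotSurfTail`** — for `0 < y < rotYdagger` and `ε > 0` there is `ρ < μ` with `rotSurfTail n ⌈εn⌉ y ≤ ρⁿ`
  eventually (`rotGrowthLe_criticalPoint`); with the eventual lower rate `rotGrowthGeRate_mu_of_pos`,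
  **`exists_rate_rotSurfTail_div`**: the Boltzmann probability of `≥ εn` surface vertices is `≤ θⁿ` eventually, `θ < 1`;
* **`tendsto_rotSurfDensity_zero` — for `0 < y < rotYdagger`, `rotSurfDensity n y → 0`**;
* the chord inequality **`rpow_rotSurfDensity_le : (y₀/y)^{rotSurfMoment n y / C⁺_n(y)} ≤ C⁺_n(y₀)/C⁺_n(y)`** and
  `le_rotSurfDensity_of_ratio_le`; with `rotGrowthGt_holds`, **`frequently_le_rotSurfDensity_of_gt` — for `y > rotYdagger`
  some `δ > 0` has `δ ≤ rotSurfDensity n y` for infinitely many `n`**; and **`eventually_le_rotSurfDensity_of_rate` — an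
  EVENTUAL lower rate `ρ > μ` at `y > rotYdagger` (`RotGrowthGeRate y ρ`, e.g. the zig-zag rate `√y` for `y > μ²`) gives
  `δ ≤ rotSurfDensity n y` eventually**.

NOT decided here: the existence of the limit density `y ∂ log μ(y)/∂y` (it needs `μ(y) = lim C⁺_n(y)^{1/n}` for `y > y_c`,
Hammersley–Torrie–Whittington 1982, not in the tree) and unconditional eventual positivity just above `y_c`.
Label: CONSOLIDATION — the printed sentence on the density, in finite-`n` form, by a different (rate-only) argument.
Lane «pcv-sawmu», seat a-idea-1 g20 (door (c-rot-density), Beaton's frame). Pure standard axioms.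
-/

noncomputable section

open Finset Filter Topology
open scoped BigOperators

namespace Literature.Probability.RandomPlanarGeometry.SAW.HV

/-! ### Vocabulary -/

/-- `m(γ) ≤ n` on `rotHpWalks n` (surface vertices are vertices). [cite: Beaton2014RotatedHoneycomb, §3.1 (arXiv v3 p. 11: "occupying m vertices in the surface")] -/
theorem surfCount_le_of_mem_rotHpWalks {n : ℕ} {l : List HV} (hl : l ∈ rotHpWalks n) : surfCount l ≤ n := by
  have h := (mem_rotHpWalks_iff.1 hl).2.2.2.1
  exact h ▸ surfCount_le_length l

/-- **The surface moment `Σ_γ m(γ) y^{m(γ)} = Σ_m m c^+_n(m) y^m = y C⁺_n'(y)`.**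
[cite: Beaton2014RotatedHoneycomb, §3.1, last paragraph (arXiv v3 p. 14: the numerator "Σ_m m c^+_n(m) y^m")] -/
def rotSurfMoment (n : ℕ) (y : ℝ) : ℝ := ∑ l ∈ rotHpWalks n, (surfCount l : ℝ) * y ^ surfCount l

/-- **The mean density of vertices in the surface, `(1/n) Σ_m m c^+_n(m) y^m / Σ_m c_n^+(m) y^m`.**
[cite: Beaton2014RotatedHoneycomb, §3.1, last paragraph (arXiv v3 p. 14: "the mean density of vertices in the surface, given by (1/n) Σ_m m c^+_n(m) y^m / Σ_m c_n^+(m) y^m = (y/n) ∂ log C^+_n(y)/∂y")] -/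
def rotSurfDensity (n : ℕ) (y : ℝ) : ℝ := rotSurfMoment n y / (n * rotHpCoeff n y)

/-- The tail `Σ_{γ : m(γ) ≥ t} y^{m(γ)}` — the weight of walks with at least `t` surface vertices.
[cite: Beaton2014RotatedHoneycomb, §3.1, last paragraph (arXiv v3 p. 14: "the density of vertices in the surface is 0 for y < y_c")] -/
def rotSurfTail (n t : ℕ) (y : ℝ) : ℝ := ∑ l ∈ (rotHpWalks n).filter (fun l => t ≤ surfCount l), y ^ surfCount l

/-- `rotSurfMoment n y ≥ 0` for `y ≥ 0`. [cite: Beaton2014RotatedHoneycomb, §3.1, last paragraph (arXiv v3 p. 14)] -/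
theorem rotSurfMoment_nonneg (n : ℕ) {y : ℝ} (hy : 0 ≤ y) : 0 ≤ rotSurfMoment n y :=
  sum_nonneg fun _ _ => mul_nonneg (Nat.cast_nonneg _) (pow_nonneg hy _)

/-- `rotSurfTail n t y ≥ 0` for `y ≥ 0`. [cite: Beaton2014RotatedHoneycomb, §3.1, last paragraph (arXiv v3 p. 14)] -/
theorem rotSurfTail_nonneg (n t : ℕ) {y : ℝ} (hy : 0 ≤ y) : 0 ≤ rotSurfTail n t y :=
  sum_nonneg fun _ _ => pow_nonneg hy _

/-- `rotSurfTail n t y ≤ C⁺_n(y)` for `y ≥ 0`. [cite: Beaton2014RotatedHoneycomb, §3.1 (arXiv v3 p. 11: C_n^+(y))] -/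
theorem rotSurfTail_le_rotHpCoeff (n t : ℕ) {y : ℝ} (hy : 0 ≤ y) : rotSurfTail n t y ≤ rotHpCoeff n y :=
  sum_le_sum_of_subset_of_nonneg (filter_subset _ _) fun _ _ _ => pow_nonneg hy _

/-- `Σ m y^m ≤ n C⁺_n(y)` (`m ≤ n`). [cite: Beaton2014RotatedHoneycomb, §3.1 (arXiv v3 p. 11: "occupying m vertices in the surface")] -/
theorem rotSurfMoment_le_mul (n : ℕ) {y : ℝ} (hy : 0 ≤ y) : rotSurfMoment n y ≤ n * rotHpCoeff n y := by
  rw [rotSurfMoment, rotHpCoeff, mul_sum]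
  exact sum_le_sum fun l hl =>
    mul_le_mul_of_nonneg_right (Nat.cast_le.2 (surfCount_le_of_mem_rotHpWalks hl)) (pow_nonneg hy _)

/-- `0 ≤ rotSurfDensity n y` for `y ≥ 0`. [cite: Beaton2014RotatedHoneycomb, §3.1, last paragraph (arXiv v3 p. 14: "the mean density of vertices in the surface")] -/
theorem rotSurfDensity_nonneg (n : ℕ) {y : ℝ} (hy : 0 ≤ y) : 0 ≤ rotSurfDensity n y :=
  div_nonneg (rotSurfMoment_nonneg n hy) (mul_nonneg (Nat.cast_nonneg _) (rotHpCoeff_nonneg n hy))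

/-- `rotSurfDensity n y ≤ 1` for `y ≥ 0` (a density). [cite: Beaton2014RotatedHoneycomb, §3.1, last paragraph (arXiv v3 p. 14: "the mean density of vertices in the surface")] -/
theorem rotSurfDensity_le_one (n : ℕ) {y : ℝ} (hy : 0 ≤ y) : rotSurfDensity n y ≤ 1 := by
  rw [rotSurfDensity]
  rcases (mul_nonneg (Nat.cast_nonneg n) (rotHpCoeff_nonneg n hy)).eq_or_lt with h | h
  · rw [← h, div_zero]; exact zero_le_one
  · exact (div_le_one h).2 (rotSurfMoment_le_mul n hy)

/-! ### Markov splitting and rescaling of the tail -/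

/-- **Markov splitting: `Σ m y^m ≤ t · C⁺_n(y) + n · rotSurfTail n t y`.**
[cite: Beaton2014RotatedHoneycomb, §3.1, last paragraph (arXiv v3 p. 14: "the density of vertices in the surface is 0 for y < y_c")] -/
theorem rotSurfMoment_le_add (n t : ℕ) {y : ℝ} (hy : 0 ≤ y) :
    rotSurfMoment n y ≤ t * rotHpCoeff n y + n * rotSurfTail n t y := by
  rw [rotSurfMoment, rotHpCoeff, rotSurfTail, sum_filter, mul_sum, mul_sum, ← sum_add_distrib]
  refine sum_le_sum fun l hl => ?_
  have hc := surfCount_le_of_mem_rotHpWalks hl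
  have h0 : 0 ≤ y ^ surfCount l := pow_nonneg hy _
  by_cases ht : t ≤ surfCount l
  · rw [if_pos ht]
    have h1 : (surfCount l : ℝ) * y ^ surfCount l ≤ n * y ^ surfCount l :=
      mul_le_mul_of_nonneg_right (Nat.cast_le.2 hc) h0
    have h2 : (0 : ℝ) ≤ t * y ^ surfCount l := mul_nonneg (Nat.cast_nonneg _) h0
    linarith
  · rw [if_neg ht, mul_zero, add_zero]
    exact mul_le_mul_of_nonneg_right (Nat.cast_le.2 (not_le.1 ht).le) h0

/-- **Rescaling of the tail: `rotSurfTail n t y ≤ (y/y')^t · C⁺_n(y')` for `0 < y ≤ y'`.**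
[cite: Beaton2014RotatedHoneycomb, §3.1 (arXiv v3 p. 11: C_n^+(y) = Σ_m c^+_n(m) y^m, a polynomial in y)] -/
theorem rotSurfTail_le_pow_mul {y y' : ℝ} (hy : 0 < y) (hyy' : y ≤ y') (n t : ℕ) :
    rotSurfTail n t y ≤ (y / y') ^ t * rotHpCoeff n y' := by
  have hy' : 0 < y' := hy.trans_le hyy'
  have hq1 : y / y' ≤ 1 := (div_le_one hy').2 hyy'
  have hq0 : 0 ≤ y / y' := div_nonneg hy.le hy'.le
  rw [rotSurfTail, rotHpCoeff, mul_sum]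
  calc ∑ l ∈ (rotHpWalks n).filter (fun l => t ≤ surfCount l), y ^ surfCount l
      ≤ ∑ l ∈ (rotHpWalks n).filter (fun l => t ≤ surfCount l), (y / y') ^ t * y' ^ surfCount l := by
        refine sum_le_sum fun l hl => ?_
        have ht : t ≤ surfCount l := (mem_filter.1 hl).2
        calc y ^ surfCount l = (y / y') ^ surfCount l * y' ^ surfCount l := by
              rw [← mul_pow, div_mul_cancel₀ _ hy'.ne']
          _ ≤ (y / y') ^ t * y' ^ surfCount l :=
              mul_le_mul_of_nonneg_right (pow_le_pow_of_le_one hq0 hq1 ht) (pow_nonneg hy'.le _)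
    _ ≤ ∑ l ∈ rotHpWalks n, (y / y') ^ t * y' ^ surfCount l :=
        sum_le_sum_of_subset_of_nonneg (filter_subset _ _) fun l _ _ =>
          mul_nonneg (pow_nonneg hq0 _) (pow_nonneg hy'.le _)

/-! ### Below `y_c`: exponentially small tails and density `→ 0` -/

/-- **Exponential tail below `y_c`: for `0 < y < rotYdagger` and `ε > 0` there is `ρ ∈ (0, μ)` with
`rotSurfTail n ⌈εn⌉ y ≤ ρⁿ` eventually** (rescale to `y_c` and use `limsup C⁺_n(y_c)^{1/n} ≤ μ`).
[cite: Beaton2014RotatedHoneycomb, §3.1, Proposition 7 (arXiv v3 p. 11: "μ(y) = μ if y ≤ y_c"), Theorem 1, and the last paragraph of §3.1 (p. 14: "the density of vertices in the surface is 0 for y < y_c")] -/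
theorem exists_rate_rotSurfTail {y ε : ℝ} (hy0 : 0 < y) (hy : y < rotYdagger) (hε : 0 < ε) :
    ∃ ρ : ℝ, 0 < ρ ∧ ρ < hexConnectiveConstant ∧
      ∀ᶠ n : ℕ in atTop, rotSurfTail n ⌈ε * n⌉₊ y ≤ ρ ^ n := by
  have hμ0 : 0 < hexConnectiveConstant := by
    rw [hexConnectiveConstant_eq_inv]; exact inv_pos.2 hexCriticalFugacity_pos_lt_one.1
  have hyc0 : 0 < rotYdagger := hy0.trans hy
  set q : ℝ := y / rotYdagger with hq
  have hq0 : 0 < q := div_pos hy0 hyc0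
  have hq1 : q < 1 := (div_lt_one hyc0).2 hy
  set b : ℝ := q ^ (ε / 2) with hb
  have hb0 : 0 < b := Real.rpow_pos_of_pos hq0 _
  have hb1 : b < 1 := Real.rpow_lt_one hq0.le hq1 (by positivity)
  refine ⟨b * hexConnectiveConstant, mul_pos hb0 hμ0, mul_lt_of_lt_one_left hμ0 hb1, ?_⟩
  have hr : hexConnectiveConstant < hexConnectiveConstant / b := by
    rw [lt_div_iff₀ hb0]; exact mul_lt_of_lt_one_right hμ0 hb1
  filter_upwards [rotGrowthLe_criticalPoint _ hr] with n hn
  have hqpow : q ^ ⌈ε * n⌉₊ ≤ b ^ (2 * n) := by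
    rw [← Real.rpow_natCast q, hb, ← Real.rpow_mul_natCast hq0.le]
    refine Real.rpow_le_rpow_of_exponent_ge hq0 hq1.le ?_
    calc ε / 2 * ((2 * n : ℕ) : ℝ) = ε * n := by push_cast; ring
      _ ≤ ⌈ε * n⌉₊ := Nat.le_ceil _
  calc rotSurfTail n ⌈ε * n⌉₊ y ≤ q ^ ⌈ε * n⌉₊ * rotHpCoeff n rotYdagger := rotSurfTail_le_pow_mul hy0 hy.le n _
    _ ≤ b ^ (2 * n) * (hexConnectiveConstant / b) ^ n :=
        mul_le_mul hqpow hn (rotHpCoeff_nonneg n hyc0.le) (pow_nonneg hb0.le _)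
    _ = (b * hexConnectiveConstant) ^ n := by
        rw [pow_mul, ← mul_pow]
        congr 1
        field_simp

/-- **The Boltzmann probability of at least `εn` surface vertices decays exponentially below `y_c`:**
for `0 < y < rotYdagger` and `ε > 0` there is `θ ∈ (0, 1)` with `rotSurfTail n ⌈εn⌉ y / C⁺_n(y) ≤ θⁿ` eventually.
[cite: Beaton2014RotatedHoneycomb, §3.1, Proposition 7 (arXiv v3 p. 11) and the last paragraph of §3.1 (p. 14: "the density of vertices in the surface is 0 for y < y_c")] -/
theorem exists_rate_rotSurfTail_div {y ε : ℝ} (hy0 : 0 < y) (hy : y < rotYdagger) (hε : 0 < ε) :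
    ∃ θ : ℝ, 0 < θ ∧ θ < 1 ∧
      ∀ᶠ n : ℕ in atTop, rotSurfTail n ⌈ε * n⌉₊ y / rotHpCoeff n y ≤ θ ^ n := by
  obtain ⟨ρ, hρ0, hρμ, hT⟩ := exists_rate_rotSurfTail hy0 hy hε
  set r : ℝ := (ρ + hexConnectiveConstant) / 2 with hr
  have hρr : ρ < r := by rw [hr]; linarith
  have hrμ : r < hexConnectiveConstant := by rw [hr]; linarith
  have hr0 : 0 < r := hρ0.trans hρr
  refine ⟨ρ / r, div_pos hρ0 hr0, (div_lt_one hr0).2 hρr, ?_⟩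
  filter_upwards [hT, rotGrowthGeRate_mu_of_pos hy0 r hr0.le hrμ] with n hTn hCn
  rw [div_pow]
  exact div_le_div₀ (pow_nonneg hρ0.le _) hTn (pow_pos hr0 _) hCn

/-- `rotSurfDensity n y ≤ t/n + rotSurfTail n t y / C⁺_n(y)` when `C⁺_n(y) > 0`, `n ≥ 1`.
[cite: Beaton2014RotatedHoneycomb, §3.1, last paragraph (arXiv v3 p. 14: "the mean density of vertices in the surface")] -/
theorem rotSurfDensity_le_add {y : ℝ} (hy : 0 ≤ y) {n : ℕ} (hn : 1 ≤ n) (hC : 0 < rotHpCoeff n y) (t : ℕ) :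
    rotSurfDensity n y ≤ (t : ℝ) / n + rotSurfTail n t y / rotHpCoeff n y := by
  have hn0 : (0 : ℝ) < n := by exact_mod_cast hn
  rw [rotSurfDensity, div_le_iff₀ (mul_pos hn0 hC)]
  have h : ((t : ℝ) / n + rotSurfTail n t y / rotHpCoeff n y) * (n * rotHpCoeff n y)
      = t * rotHpCoeff n y + n * rotSurfTail n t y := by
    field_simp
  rw [h]
  exact rotSurfMoment_le_add n t hy

/-- **The density of surface vertices is `0` below `y_c` (finite-`n` form): for `0 < y < rotYdagger`,
`rotSurfDensity n y → 0`.**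
[cite: Beaton2014RotatedHoneycomb, §3.1, last paragraph (arXiv v3 p. 14: "it can be seen that the density of vertices in the surface is 0 for y < y_c")] -/
theorem tendsto_rotSurfDensity_zero {y : ℝ} (hy0 : 0 < y) (hy : y < rotYdagger) :
    Tendsto (fun n : ℕ => rotSurfDensity n y) atTop (𝓝 0) := by
  refine tendsto_order.2 ⟨fun a ha => Eventually.of_forall fun n => ha.trans_le (rotSurfDensity_nonneg n hy0.le),
    fun a ha => ?_⟩
  have hε : 0 < a / 3 := by positivity
  obtain ⟨ρ, hρ0, hρμ, hT⟩ := exists_rate_rotSurfTail hy0 hy hε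
  set r : ℝ := (ρ + hexConnectiveConstant) / 2 with hr
  have hρr : ρ < r := by rw [hr]; linarith
  have hrμ : r < hexConnectiveConstant := by rw [hr]; linarith
  have hr0 : 0 < r := hρ0.trans hρr
  have hθ : Tendsto (fun n : ℕ => (ρ / r) ^ n) atTop (𝓝 0) :=
    tendsto_pow_atTop_nhds_zero_of_lt_one (div_nonneg hρ0.le hr0.le) ((div_lt_one hr0).2 hρr)
  have h1 : Tendsto (fun n : ℕ => (1 : ℝ) / n) atTop (𝓝 0) := tendsto_one_div_atTop_nhds_zero_nat
  filter_upwards [hT, rotGrowthGeRate_mu_of_pos hy0 r hr0.le hrμ, hθ.eventually (gt_mem_nhds hε),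
    h1.eventually (gt_mem_nhds hε), eventually_ge_atTop 1] with n hTn hCn hθn h1n hn
  have hn0 : (0 : ℝ) < n := by exact_mod_cast hn
  have hC : 0 < rotHpCoeff n y := (pow_pos hr0 n).trans_le hCn
  have hi : (⌈a / 3 * n⌉₊ : ℝ) / n < a / 3 + a / 3 := by
    rw [div_lt_iff₀ hn0]
    have h2 := Nat.ceil_lt_add_one (by positivity : 0 ≤ a / 3 * n)
    have h3 : 1 < a / 3 * n := (div_lt_iff₀ hn0).1 h1n
    linarith
  have hii : rotSurfTail n ⌈a / 3 * n⌉₊ y / rotHpCoeff n y < a / 3 := by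
    refine lt_of_le_of_lt ?_ hθn
    rw [div_pow]
    exact div_le_div₀ (pow_nonneg hρ0.le _) hTn (pow_pos hr0 _) hCn
  calc rotSurfDensity n y ≤ (⌈a / 3 * n⌉₊ : ℝ) / n + rotSurfTail n ⌈a / 3 * n⌉₊ y / rotHpCoeff n y :=
        rotSurfDensity_le_add hy0.le hn hC _
    _ < a / 3 + a / 3 + a / 3 := add_lt_add hi hii
    _ = a := by ring

/-! ### Above `y_c`: the chord inequality and positive density -/

/-- **Chord inequality (weighted AM–GM, i.e. convexity of `log C⁺_n(eᵗ)`):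
`(y₀/y)^{rotSurfMoment n y / C⁺_n(y)} ≤ C⁺_n(y₀)/C⁺_n(y)`** for `y, y₀ > 0` with `C⁺_n(y) > 0`.
[cite: Beaton2014RotatedHoneycomb, §3.1, last paragraph (arXiv v3 p. 14, footnote: "the convexity of log μ(y)")] -/
theorem rpow_rotSurfDensity_le {y y₀ : ℝ} (hy : 0 < y) (hy₀ : 0 < y₀) {n : ℕ} (hC : 0 < rotHpCoeff n y) :
    (y₀ / y) ^ (rotSurfMoment n y / rotHpCoeff n y) ≤ rotHpCoeff n y₀ / rotHpCoeff n y := by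
  have hq : 0 < y₀ / y := div_pos hy₀ hy
  have hyne : y ≠ 0 := hy.ne'
  have key := Real.geom_mean_le_arith_mean_weighted (rotHpWalks n)
    (fun l => y ^ surfCount l / rotHpCoeff n y) (fun l => (y₀ / y) ^ (surfCount l : ℝ))
    (fun l _ => div_nonneg (pow_nonneg hy.le _) hC.le)
    (by rw [← sum_div, ← rotHpCoeff, div_self hC.ne'])
    (fun l _ => (Real.rpow_pos_of_pos hq _).le)
  have hL : ∏ l ∈ rotHpWalks n, ((y₀ / y) ^ (surfCount l : ℝ)) ^ (y ^ surfCount l / rotHpCoeff n y)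
      = (y₀ / y) ^ (rotSurfMoment n y / rotHpCoeff n y) := by
    rw [rotSurfMoment, sum_div, Real.rpow_sum_of_pos hq]
    refine prod_congr rfl fun l _ => ?_
    rw [← Real.rpow_mul hq.le, mul_div_assoc]
  have hR : ∑ l ∈ rotHpWalks n, y ^ surfCount l / rotHpCoeff n y * (y₀ / y) ^ (surfCount l : ℝ)
      = rotHpCoeff n y₀ / rotHpCoeff n y := by
    rw [rotHpCoeff, rotHpCoeff, sum_div]
    refine sum_congr rfl fun l _ => ?_
    rw [Real.rpow_natCast, div_mul_eq_mul_div, ← mul_pow, show y * (y₀ / y) = y₀ by field_simp]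
  rw [← hL, ← hR]
  exact key

/-- **From a ratio bound to a density bound:** if `0 < y₀ < y`, `C⁺_n(y) > 0`, `n ≥ 1` and `C⁺_n(y₀)/C⁺_n(y) ≤ θⁿ`, then
`log θ / log (y₀/y) ≤ rotSurfDensity n y` (for `0 < θ < 1` the bound is positive).
[cite: Beaton2014RotatedHoneycomb, §3.1, last paragraph (arXiv v3 p. 14: "the density of vertices in the surface … is positive for y > y_c")] -/
theorem le_rotSurfDensity_of_ratio_le {y y₀ θ : ℝ} (hy₀ : 0 < y₀) (hlt : y₀ < y)
    {n : ℕ} (hn : 1 ≤ n) (hC : 0 < rotHpCoeff n y) (h : rotHpCoeff n y₀ / rotHpCoeff n y ≤ θ ^ n) :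
    Real.log θ / Real.log (y₀ / y) ≤ rotSurfDensity n y := by
  have hy : 0 < y := hy₀.trans hlt
  have hq0 : 0 < y₀ / y := div_pos hy₀ hy
  have hq1 : y₀ / y < 1 := (div_lt_one hy).2 hlt
  have hlq : Real.log (y₀ / y) < 0 := Real.log_neg hq0 hq1
  have hn0 : (0 : ℝ) < n := by exact_mod_cast hn
  have key := (rpow_rotSurfDensity_le hy hy₀ hC).trans h
  have hlog := Real.log_le_log (Real.rpow_pos_of_pos hq0 _) key
  rw [Real.log_rpow hq0, Real.log_pow] at hlog
  have hE : (n : ℝ) * Real.log θ / Real.log (y₀ / y) ≤ rotSurfMoment n y / rotHpCoeff n y :=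
    (div_le_iff_of_neg hlq).2 hlog
  rw [rotSurfDensity, mul_comm (n : ℝ), ← div_div, le_div_iff₀ hn0]
  calc Real.log θ / Real.log (y₀ / y) * n = n * Real.log θ / Real.log (y₀ / y) := by ring
    _ ≤ rotSurfMoment n y / rotHpCoeff n y := hE

/-- **Positive density above `y_c`, frequently form: for `y > rotYdagger` there is `δ > 0` with `δ ≤ rotSurfDensity n y`
for infinitely many `n`** (a rate `r > μ` is reached infinitely often at `y`, `rotGrowthGt_holds`, while `C⁺_n(y_c) ≤ sⁿ`
eventually for `μ < s < r`, `rotGrowthLe_criticalPoint`; then the chord inequality from `y_c` to `y`).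
[cite: Beaton2014RotatedHoneycomb, §3.1, Theorem 1 / Proposition 7 (arXiv v3 p. 11: "μ(y) > μ if y > y_c") and the last paragraph of §3.1 (p. 14: "the density of vertices in the surface … is positive for y > y_c")] -/
theorem frequently_le_rotSurfDensity_of_gt {y : ℝ} (hy : rotYdagger < y) :
    ∃ δ : ℝ, 0 < δ ∧ ∃ᶠ n : ℕ in atTop, δ ≤ rotSurfDensity n y := by
  have hμ0 : 0 < hexConnectiveConstant := by
    rw [hexConnectiveConstant_eq_inv]; exact inv_pos.2 hexCriticalFugacity_pos_lt_one.1
  have hy₀ : 0 < rotYdagger := rotYdagger_pos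
  have hy0 : 0 < y := hy₀.trans hy
  obtain ⟨r, hμr, hfr⟩ := rotGrowthGt_holds hy
  set s : ℝ := (hexConnectiveConstant + r) / 2 with hs
  have hμs : hexConnectiveConstant < s := by rw [hs]; linarith
  have hsr : s < r := by rw [hs]; linarith
  have hs0 : 0 < s := hμ0.trans hμs
  have hr0 : 0 < r := hs0.trans hsr
  have hθ0 : 0 < s / r := div_pos hs0 hr0
  have hθ1 : s / r < 1 := (div_lt_one hr0).2 hsr
  have hq0 : 0 < rotYdagger / y := div_pos hy₀ hy0
  have hq1 : rotYdagger / y < 1 := (div_lt_one hy0).2 hy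
  refine ⟨Real.log (s / r) / Real.log (rotYdagger / y),
    div_pos_of_neg_of_neg (Real.log_neg hθ0 hθ1) (Real.log_neg hq0 hq1), ?_⟩
  refine (hfr.and_eventually ((rotGrowthLe_criticalPoint s hμs).and (eventually_ge_atTop 1))).mono ?_
  rintro n ⟨hrn, hsn, hn⟩
  have hC : 0 < rotHpCoeff n y := (pow_pos hr0 n).trans_le hrn
  refine le_rotSurfDensity_of_ratio_le hy₀ hy hn hC ?_
  rw [div_pow]
  exact div_le_div₀ (pow_nonneg hs0.le _) hsn (pow_pos hr0 _) hrn

/-- **Positive density, eventual form, from an eventual lower rate above `μ`:** if `y > rotYdagger` carries an EVENTUAL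
lower rate `ρ > μ` (`RotGrowthGeRate y ρ` — e.g. the surface zig-zag rate `ρ = √y` when `y > μ² = 2 + √2`), then some
`δ > 0` has `δ ≤ rotSurfDensity n y` eventually.
[cite: Beaton2014RotatedHoneycomb, §3.1, Proposition 7 (arXiv v3 p. 11: "μ(y) ≥ max{μ, √y}") and the last paragraph of §3.1 (p. 14: "the density of vertices in the surface … is positive for y > y_c")] -/
theorem eventually_le_rotSurfDensity_of_rate {y ρ : ℝ} (hy : rotYdagger < y) (hμρ : hexConnectiveConstant < ρ)
    (hge : RotGrowthGeRate y ρ) :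
    ∃ δ : ℝ, 0 < δ ∧ ∀ᶠ n : ℕ in atTop, δ ≤ rotSurfDensity n y := by
  have hμ0 : 0 < hexConnectiveConstant := by
    rw [hexConnectiveConstant_eq_inv]; exact inv_pos.2 hexCriticalFugacity_pos_lt_one.1
  have hy₀ : 0 < rotYdagger := rotYdagger_pos
  have hy0 : 0 < y := hy₀.trans hy
  set r : ℝ := (hexConnectiveConstant + ρ) / 2 with hr
  have hμr : hexConnectiveConstant < r := by rw [hr]; linarith
  have hrρ : r < ρ := by rw [hr]; linarith
  have hr0 : 0 < r := hμ0.trans hμr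
  set s : ℝ := (hexConnectiveConstant + r) / 2 with hs
  have hμs : hexConnectiveConstant < s := by rw [hs]; linarith
  have hsr : s < r := by rw [hs]; linarith
  have hs0 : 0 < s := hμ0.trans hμs
  have hθ0 : 0 < s / r := div_pos hs0 hr0
  have hθ1 : s / r < 1 := (div_lt_one hr0).2 hsr
  have hq0 : 0 < rotYdagger / y := div_pos hy₀ hy0
  have hq1 : rotYdagger / y < 1 := (div_lt_one hy0).2 hy
  refine ⟨Real.log (s / r) / Real.log (rotYdagger / y),
    div_pos_of_neg_of_neg (Real.log_neg hθ0 hθ1) (Real.log_neg hq0 hq1), ?_⟩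
  filter_upwards [hge r hr0.le hrρ, rotGrowthLe_criticalPoint s hμs, eventually_ge_atTop 1] with n hrn hsn hn
  have hC : 0 < rotHpCoeff n y := (pow_pos hr0 n).trans_le hrn
  refine le_rotSurfDensity_of_ratio_le hy₀ hy hn hC ?_
  rw [div_pow]
  exact div_le_div₀ (pow_nonneg hs0.le _) hsn (pow_pos hr0 _) hrn

end Literature.Probability.RandomPlanarGeometry.SAW.HV
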